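import Summits.CriticalPhenomena.PercolationContinuityZ3.Theorems.PercNearOneGluingNoHeavyLowerTailSunflowerChainCover
import HarnessLib

/-!
# `NoHeavyLowerTail` (crux stmt-CriticalPhenomena-4575), abstract sunflower cubic: STAIRCASE CNF CORES (CHAIN-GRAPH CORES) HAVE
# THE COVER PROPERTY — hence GRADEDLY SAFE, SAFE, and SAFE next to any safe core on a disjoint block (consequences of
# `…SunflowerChainCover`)

Support file (seat `prim-ineq-prove-1` gen 44; `--supports stmt-CriticalPhenomena-4575`).  No `sorry`, no named facts.
Memo: run/shared/lean/prim/prim-ineq-prove-1/FINDING-CHAINCOVER-prove1-g44.md §2.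

With `famIn (stair P Q) 𝒰 = ChainGame.G (lawX p P) (cdfY p Q) (avoid P Q 𝒰)` (`famIn_stair_eq`) and the balancedness of the chain game
(`ChainGame.G_le_prod_weights`: `G R ≤ ∏_{k ∈ R} τ k`, `∏_k τ k = G univ`, `τ k = G(pre (k+1))/G(pre k) ∈ (0,1]`):
* **`cover_stair`** — the weights `t C = ∏_{k : C_k = C} τ k` are a balanced certificate, so `Cover p (L ∪ Rb) (stair P Q)` (`cover_of_weights`);
* **`gsafe_stair`** — GRADED SAFETY (`gsafe_of_cover`), **`safe_stair`** — SAFETY (Lemma A for all numbers of petals and all the rows of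
  `…SunflowerSafeCalculus`), for every staircase CNF core of positive probability;
* **`safe_stair_union`** — `clauseCore (stair P Q) ∪ A₂` is SAFE for every safe up-set `A₂` of positive probability determined by the
  coordinates outside the two blocks (`safe_union_of_gsafe`): e.g. the edge-core of `Γ_chain ⊔ Γ` for every A-safe graph `Γ`
  (C₅, Petersen, And_k, …), extending `…SunflowerUnionEdge` / `…SunflowerUnionMatching` (`Γ ⊔ K₂`, `Γ ⊔ K_{m,n}`) from complete bipartite
  components to all difference graphs (half graphs `H_m`, …).
The first instances outside every earlier calculus are the half graphs `H_m`, `m ≥ 3` (`|𝒯| = m + 1 ≥ 4`: not read-once, more than three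
transversals, cost game not submodular).  Numerically (memo §3) every TREE core also has a marginal vector in its core; open.
-/

noncomputable section

namespace Summit.CriticalPhenomena.PercolationContinuityZ3.Theorems.SunflowerPartition

namespace SafeCalc

open MeasureTheory Finset
open Literature.Probability.LatticeModels Literature.Probability.Percolation
open TwoGenCore (wmiss)

variable {ι : Type*} [DecidableEq ι] (p : ι → unitInterval)

section Stair

variable {N : ℕ} {P Q : Fin N → Finset ι}

/-! ### The cover property, graded safety, safety -/

/-- **COVER for staircase CNFs (chain-graph cores).**  If the core has positive probability, `stair P Q` has the cover
property on the block `L ∪ Rb`. [this work] -/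
theorem cover_stair (hS : IsStair P Q) (hpos : 0 < famIn p (blockP P ∪ blockQ Q) (stair P Q) ∅) :
    Cover p (blockP P ∪ blockQ Q) (stair P Q) := by
  classical
  set x := lawX p P with hx
  set F := cdfY p Q with hF
  have hx0 : ∀ i, 0 ≤ x i := lawX_nonneg p
  have hF0 : ∀ κ, 0 ≤ F κ := cdfY_nonneg p
  have hFm : Monotone F := cdfY_mono p
  have hGu : 0 < ChainGame.G x F univ := by rwa [hx, hF, ← famIn_stair_empty p hS]
  -- the weights
  set τ : Fin N → ℝ := fun k => ChainGame.G x F (ChainGame.pre ((k : ℕ) + 1)) / ChainGame.G x F (ChainGame.pre (k : ℕ))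
    with hτ
  have hτ0 : ∀ k, 0 ≤ τ k := fun k => (ChainGame.weight_pos hx0 hFm hGu k).le
  have hτ1 : ∀ k, τ k ≤ 1 := fun k => ChainGame.weight_le_one hx0 hFm hGu k
  let t : Finset ι → ℝ := fun C => ∏ k ∈ univ.filter (fun k => stairClause P Q k = C), τ k
  refine cover_of_weights p _ (stair P Q) t (fun C _ => prod_nonneg fun k _ => hτ0 k)
    (fun C _ => prod_le_one (fun k _ => hτ0 k) fun k _ => hτ1 k) (le_of_eq ?_) fun 𝒰 h𝒰 => ?_
  · -- `∏_{C ∈ 𝒯} t C = ∏_k τ k = G univ / G ∅ = famIn ∅`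
    change ∏ C ∈ stair P Q, ∏ k ∈ univ.filter (fun k => stairClause P Q k = C), τ k = _
    rw [prod_fiberwise_of_maps_to (s := univ) (t := stair P Q) (g := stairClause P Q)
      (fun k _ => mem_image_of_mem _ (mem_univ k)), ChainGame.prod_weights_eq hx0 hFm hGu,
      G_lawX_cdfY_empty, div_one, famIn_stair_empty p hS]
  · -- `famIn 𝒰 = G R_𝒰 ≤ ∏_{k ∈ R_𝒰} τ k = ∏_{C ∈ 𝒯 ∖ 𝒰} t C`
    rw [famIn_stair_eq p hS 𝒰]
    refine (ChainGame.G_le_prod_weights hx0 hF0 hFm hGu (avoid P Q 𝒰)).trans (le_of_eq ?_)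
    rw [G_lawX_cdfY_empty, one_mul]
    change ∏ k ∈ avoid P Q 𝒰, τ k = ∏ C ∈ stair P Q \ 𝒰, ∏ k ∈ univ.filter (fun k => stairClause P Q k = C), τ k
    have hfib : ∀ C ∈ stair P Q \ 𝒰, univ.filter (fun k => stairClause P Q k = C) =
        (avoid P Q 𝒰).filter (fun k => stairClause P Q k = C) := by
      intro C hC
      ext k
      simp only [mem_filter, mem_univ, true_and, avoid]
      exact ⟨fun h => ⟨by rw [h]; exact (mem_sdiff.1 hC).2, h⟩, fun h => h.2⟩
    have hrhs : ∏ C ∈ stair P Q \ 𝒰, ∏ k ∈ univ.filter (fun k => stairClause P Q k = C), τ k =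
        ∏ C ∈ stair P Q \ 𝒰, ∏ k ∈ (avoid P Q 𝒰).filter (fun k => stairClause P Q k = C), τ k :=
      prod_congr rfl fun C hC => by rw [hfib C hC]
    rw [hrhs]
    exact (prod_fiberwise_of_maps_to (s := avoid P Q 𝒰) (t := stair P Q \ 𝒰) (g := stairClause P Q)
      (fun k hk => mem_sdiff.2 ⟨mem_image_of_mem _ (mem_univ k), (mem_filter.1 hk).2⟩) τ).symm

/-- The block point `(L ∪ Rb) ∖ T` lies in the core iff no clause is inside the missing set `T`. [this work] -/
theorem sdiff_mem_clauseCore_stair_iff (T : Finset ι) :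
    (((blockP P ∪ blockQ Q) \ T : Finset ι) : Set ι) ∈ clauseCore (stair P Q) ↔ ∀ C ∈ stair P Q, ¬ C ⊆ T := by
  refine forall₂_congr fun C hC => ?_
  constructor
  · rintro ⟨e, he, heT⟩ hCT
    rw [Finset.mem_coe, mem_sdiff] at heT
    exact heT.2 (hCT he)
  · intro h
    obtain ⟨e, he, heT⟩ := not_subset.1 h
    exact ⟨e, he, by rw [Finset.mem_coe, mem_sdiff]; exact ⟨subset_of_mem_stair P Q hC he, heT⟩⟩

omit [DecidableEq ι] in
/-- `hitSet 𝒯 ∅` is the CNF core `clauseCore 𝒯`. [this work] -/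
theorem hitSet_empty_eq_clauseCore (𝒯 : Finset (Finset ι)) : hitSet 𝒯 ∅ = clauseCore 𝒯 := by
  ext ω
  exact forall₂_congr fun C _ => ⟨fun h => h (notMem_empty C), fun h _ => h⟩

/-- The core of a staircase CNF is determined by the two blocks. [this work] -/
theorem determinedBy_clauseCore_stair :
    DeterminedBy (clauseCore (stair P Q)) (↑(blockP P ∪ blockQ Q) : Set ι) := by
  rw [← biUnion_stair]
  exact determinedBy_clauseCore _

/-- **STAIRCASE CNF CORES ARE GRADEDLY SAFE** (chain-graph cores; `GSafe` of `…SunflowerGradedSafe`), whenever the core has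
positive probability. [this work] -/
theorem gsafe_stair [Fintype ι] (hS : IsStair P Q) (hA : 0 < (prodBernoulli p).real (clauseCore (stair P Q))) :
    GSafe p (blockP P ∪ blockQ Q) (clauseCore (stair P Q)) := by
  have h𝒯a : ∀ C ∈ stair P Q, C ⊆ blockP P ∪ blockQ Q := fun C hC => subset_of_mem_stair P Q hC
  have hpos : 0 < famIn p (blockP P ∪ blockQ Q) (stair P Q) ∅ := by
    rwa [famIn_eq_real_hitSet p _ h𝒯a, hitSet_empty_eq_clauseCore]
  refine gsafe_of_cover p _ (determinedBy_clauseCore_stair (P := P) (Q := Q)) (isUpperSet_clauseCore _) hA (stair P Q)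
    h𝒯a (fun C hC => ?_) (fun T _ hbad => ?_) (cover_stair p hS hpos)
  · rw [sdiff_mem_clauseCore_stair_iff]
    exact fun h => h C hC subset_rfl
  · rw [sdiff_mem_clauseCore_stair_iff] at hbad
    push Not at hbad
    exact hbad

/-- … hence **SAFE**: `∏ μ(V i) ≤ μ(core)^(n−1)` for every family of up-sets meeting pairwise inside the core (Lemma A for all
numbers of petals, (C1-law), the `H`/`G`/`T` rows, Kahn's Conjecture 5 on complements — `…SunflowerSafeCalculus`). [this work] -/
theorem safe_stair [Fintype ι] (hS : IsStair P Q) (hA : 0 < (prodBernoulli p).real (clauseCore (stair P Q))) :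
    Safe p (clauseCore (stair P Q)) :=
  safe_of_gsafe p _ (determinedBy_clauseCore_stair (P := P) (Q := Q)) (isUpperSet_clauseCore _) (gsafe_stair p hS hA)

/-- **DISJUNCTION WITH ANY SAFE CORE.**  If `A₂` is a safe up-set of positive probability determined by the coordinates outside
the two blocks, then `clauseCore (stair P Q) ∪ A₂` is safe — e.g. the edge-core of `Γ_chain ⊔ Γ` for every A-safe graph `Γ`.
[this work] -/
theorem safe_stair_union [Fintype ι] (hS : IsStair P Q) (hA : 0 < (prodBernoulli p).real (clauseCore (stair P Q)))
    {A₂ : Set (Set ι)} (hd₂ : DeterminedBy A₂ (↑(blockP P ∪ blockQ Q) : Set ι)ᶜ) (hu₂ : IsUpperSet A₂)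
    (hpos₂ : 0 < (prodBernoulli p).real A₂) (h₂ : Safe p A₂) : Safe p (clauseCore (stair P Q) ∪ A₂) :=
  safe_union_of_gsafe p _ (determinedBy_clauseCore_stair (P := P) (Q := Q)) hd₂ (isUpperSet_clauseCore _) hu₂ hpos₂
    (gsafe_stair p hS hA) h₂

/-- Positive coordinate probabilities and nonempty clauses give a core of positive probability. [this work] -/
theorem real_clauseCore_stair_pos [Fintype ι] (hne : ∀ k, (stairClause P Q k).Nonempty)
    (hp : ∀ e ∈ blockP P ∪ blockQ Q, 0 < (p e : ℝ)) : 0 < (prodBernoulli p).real (clauseCore (stair P Q)) :=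
  real_clauseCore_pos p _ (stair P Q) (fun C hC => subset_of_mem_stair P Q hC)
    (fun C hC => by obtain ⟨k, _, rfl⟩ := mem_image.1 hC; exact hne k) hp

end Stair

end SafeCalc

end Summit.CriticalPhenomena.PercolationContinuityZ3.Theorems.SunflowerPartition
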